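import Summits.BirchSwinnertonDyer.BirchSwinnertonDyer.Theses.TwistFamilyManinDescent
import HarnessLib

/-!
# Route `TwistFamilyManinDescent`, LINE 18R (bsd-idea-3 g7), glue G18R `OrdinaryCornerOfSerreTateDepth`
# (stmt-BirchSwinnertonDyer-27664) — PROVED BY NAME (the planner's `Sketch18R.lean` argument, tree theorems only)

Cell `pub/bsd-wall`, D-0145 line `route-BirchSwinnertonDyer-TeichmullerTwistDescent`, seat `bsd-line-ttd-p1` g9,
working the planner-of-record's TFMD LINE 18R. BSD is NOT proved by this; Manin's conjecture is not proved by this;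
the LINE-18R cruxes I9 (`OrdinaryCornerOptimalSerreTateDeep`, stmt-27660), K18a″
(`OrdinaryCornerDeepEdixhovenDichotomy`, stmt-27661), K18b″ (`OrdinaryCornerDeepUnstarredNotBottom`, stmt-27662)
and the bookkeeping item `OrdinaryCornerOffTable` (stmt-27663) stay OPEN here. This file closes ONLY the glue.

## Statement (verbatim the route decl)

`OrdinaryCornerOptimalSerreTateDeep → OrdinaryCornerDeepEdixhovenDichotomy → OrdinaryCornerDeepUnstarredNotBottom →
OrdinaryCornerOffTable → OrdinaryCornerManinResidual`.

## Proof

Case split on the ordinary-corner table row `(5; v₅Δ_min ∈ {3,9}) ∨ (7; v₇Δ_min ∈ {2,4,8,10})`. Off it, `OffTable`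
verbatim. On it: DEEP from I9; the level of the parametrisation datum is the conductor
(`IsNewformOf.level_eq_conductorNorm_of_exists_isNewformOf`, from modularity `exists_isNewformOf`), `subst`;
assuming `p ∣ c`, K18a″ gives `v_pΔ_min < 6 ∧ BOTTOM(χ)` for every quadratic primitive `χ` mod `p`; `v < 6` leaves
the unstarred rows `(5;3)`, `(7;2)`, `(7;4)`, and K18b″ at the Legendre character
(`isQuadratic_quadraticChar_ringHomComp`, `isPrimitive_quadraticChar_ringHomComp`, `p ≠ 2`) contradicts BOTTOM.
Design: theorems only; no definition, no named fact, no `sorry`; axioms `propext`, `Classical.choice`, `Quot.sound`.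
-/

set_option autoImplicit false
-- the Theorems directory repeats the summit name (sibling precedent `TwistFamilyManinDescentStrongIsUnstarredOfKummerFree.lean`)
set_option linter.dupNamespace false

namespace Summit.BirchSwinnertonDyer.BirchSwinnertonDyer.Theorems.TwistFamilyManinDescent

open Summit.BirchSwinnertonDyer.BirchSwinnertonDyer.Theses.TwistFamilyManinDescent
open Literature.NumberTheory.EllipticCurves.ModularForms

/-- **Glue G18R** (stmt-BirchSwinnertonDyer-27664), by name: I9 (optimal ⇒ Serre–Tate-deep) → K18a″ (deep
dichotomy: `p ∣ c ⇒ v_pΔ_min < 6 ∧ BOTTOM`) → K18b″ (deep unstarred ⇒ `¬BOTTOM`) → OffTable (vacuous rows) →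
`OrdinaryCornerManinResidual` (the planner's `Sketch18R.ordinaryCornerOfSerreTateDepth_proof`). -/
theorem ordinaryCornerOfSerreTateDepth_proof : OrdinaryCornerOfSerreTateDepth := by
  intro hI hA hB hOff hM hAU hC hnf W _ _ N _ D p hp h57 hRay hSS hN hirr hadd hopt
  by_cases hrows : ((p = 5 ∧ padicValInt 5 W.minimalDiscriminantInt ∈ ({3, 9} : Finset ℕ)) ∨
      (p = 7 ∧ padicValInt 7 W.minimalDiscriminantInt ∈ ({2, 4, 8, 10} : Finset ℕ)))
  · haveI : Fact p.Prime := ⟨hp⟩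
    have hdeep := hI W D p hp hrows hN hirr hadd hopt
    have hNc : N = W.conductorNorm ℤ :=
      IsNewformOf.level_eq_conductorNorm_of_exists_isNewformOf hnf D.isNewformOf
    subst hNc
    intro hdvd
    obtain ⟨hv6, hbot⟩ := hA W p D hN hrows hirr hadd hopt hdeep hdvd
    have hrows' : ((p = 5 ∧ padicValInt 5 W.minimalDiscriminantInt = 3) ∨
        (p = 7 ∧ padicValInt 7 W.minimalDiscriminantInt ∈ ({2, 4} : Finset ℕ))) := by
      rcases hrows with ⟨hp5, h⟩ | ⟨hp7, h⟩
      · subst hp5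
        refine Or.inl ⟨rfl, ?_⟩
        simp only [Finset.mem_insert, Finset.mem_singleton] at h
        rcases h with h | h
        · exact h
        · exfalso; rw [h] at hv6; exact absurd hv6 (by norm_num)
      · subst hp7
        refine Or.inr ⟨rfl, ?_⟩
        simp only [Finset.mem_insert, Finset.mem_singleton] at h ⊢
        rcases h with h | h | h | h
        · exact Or.inl h
        · exact Or.inr h
        · exfalso; rw [h] at hv6; exact absurd hv6 (by norm_num)
        · exfalso; rw [h] at hv6; exact absurd hv6 (by norm_num)
    have hp2 : p ≠ 2 := by rcases h57 with rfl | rfl <;> decide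
    exact hB W p D hN hrows' hirr hadd hopt hdeep _ (isQuadratic_quadraticChar_ringHomComp p)
      (isPrimitive_quadraticChar_ringHomComp p hp2)
      (hbot _ (isQuadratic_quadraticChar_ringHomComp p) (isPrimitive_quadraticChar_ringHomComp p hp2))
  · exact hOff hM hAU hC hnf W D p hp h57 hRay hSS hrows hN hirr hadd hopt

end Summit.BirchSwinnertonDyer.BirchSwinnertonDyer.Theorems.TwistFamilyManinDescent
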